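import Summits.QuantumFields.BalabanUV.Beta.AccretiveCombesThomasSandwich
import Summits.QuantumFields.BalabanUV.Beta.MultiscaleCombesThomas

/-!
# `Summit.QuantumFields.BalabanUV.Beta.AccretiveCombesThomasSandwichLocal` — the `Q`-SANDWICH with LOCAL
# PREFACTORS: unit-lattice entries `(Q A⁻¹ Q^*)(y,y′) = q_y^* · A⁻¹ q_{y′}` of a fine-lattice inverse that is
# conjugated-coercive only against a SITE-DEPENDENT profile — the `k`-uniform ℓ²-PAIRING currency, packaged
# for the (2.16) sandwich consumers; weighted row sums; the (2.16)-shape END for the sandwiched FAMILY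

HONEST FRAMING (page 1 of everything in this cell).  Discharging `FlowStep.BetaPertH` would make
Bałaban's ultraviolet stability UNCONDITIONAL — a constructive-QFT result; it is NOT the continuum
limit and NOT the Clay problem.  This module discharges nothing of `BetaPertH`; [folklore] linear algebra,
kernel-checked (unit `b2b-balaban-beta-d4-p3`, road P3 «reduction road», gen 9; written on the row-D4
OWNER's GO, journal l.18551, after the cross-read C-d4p3-28 of the owner's site-local engine
`MultiscaleCombesThomas` p228128).  HONEST DEPENDENCY: continuum YM on T⁴ ⇐ BetaPertH ∧ nine spine
estimates (0/9 proved); BetaPertH ⇐ (D1) ∧ (D4) ∧ CAP+tail; G-an2-4 gates asym, D1 and NE2/3/4.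

WHY THIS FILE.  `AccretiveCombesThomasSandwich` (this lineage, p212396) bounds the unit-lattice sandwich
entry `q_y^* A⁻¹ q_{y′}` from conjugated coercivity of the fine operator `A` with ONE GLOBAL constant `m`.
The multi-region averaged operator of [Balaban1985BackgroundPropagators] (3.24) p. 394 has NO useful global
conjugated-coercivity constant: its coercivity is LOCAL, of order `(L^jη)⁻²` on the region `Λ_j` (co-owner
beta-d4-p2's `MultiscaleCoercive`), while the conjugation defect of a scale-adapted weight on `Λ_j` is of the
same local order `κ²δ₀²(L^jη)⁻²` (owner an4's `MultiscaleCombesThomasBudget` ∕ `…Covariant` ∕ `…Averaging`,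
p228368 ∕ p228966 ∕ p229366) — at the low levels the defect dwarfs the top-level constant, so the global budget
fails and only the owner's SITE-LOCAL engine (`MultiscaleCombesThomas.combesThomas_local`: local profile
`μ > 0` ⟹ `|u^*x| ≤ e^{−κR}·‖u/√μ‖·‖v/√μ‖`) applies.  This file is the sandwich consumer of that engine:
* §1 `norm_sandwich_inv_le_local` — `|q_y^* A⁻¹ q_{y′}| ≤ e^{−κD(y,y′)}·√(Σ_x ‖q_y(x)‖²/μ_x)·√(Σ_x ‖q_{y′}(x)‖²/μ_x)`
  for any fine-site profile `μ > 0` along the block-constant weights `x ↦ D(blk x, y′)`;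
* §2 BLOCK-CONSTANT profiles `μ_x = ν(blk x)`: `norm_sandwich_inv_le_blockLocal` —
  `|q_y^* A⁻¹ q_{y′}| ≤ N·e^{−κD(y,y′)}/√(ν_y ν_{y′})` (`‖q_y‖² ≤ N`): exponential decay with the GEOMETRIC-MEAN
  local prefactor — the ENTRY ∕ ℓ²-pairing currency of (3.42)'s local-prefactor shape (print's (3.42) p. 397
  itself is a sup-norm operator bound with ONE prefactor `(L^jη)²` at the target scale; locator only);
* §3 weighted row sums: `wrs_sandwich_inv_local` against the profile-weighted unit-lattice sum
  `Σ_{y′} e^{−(κ−κ′)D(y,y′)}/√(ν_yν_{y′}) ≤ L`, and `wrs_sandwich_inv_floor` — with a FLOOR `ν ≥ ν₀ > 0` the plain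
  sum `Σ_{y′} e^{−(κ−κ′)D(y,y′)} ≤ L` gives `WRS κ′ D (sandwich A q) (N/ν₀·L)`.  THE HONEST POINT: for the
  multi-region operator the floor sits at the TOP scale, `ν₀ = κ₀(L^kη)⁻²` (`= κ₀` in units `L^kη = 1`), so the
  unit-lattice sandwich bound IS globally `k`-uniform — but it is reached only THROUGH the local engine, never
  from a global conjugated-coercivity hypothesis (which is false at the budget level);
* §4 the FAMILY: `σ ↦ A(σ)` entrywise holomorphic on `|σ| < R`, uniformly LOCALLY conjugated-coercive there ⟹
  `wrs_sandwich_sub_zero_local`: `WRS κ′ D (S_σ − S_0) (2(N/ν₀·L)/R·‖σ‖)` — the (2.16) shape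
  ([Balaban1988RG2Cluster] (2.16) p. 16, locator) through `WRS.sub_apply_zero_of_differentiableOn` BY NAME;
* §5 a one-site witness (joint satisfiability of §2's hypotheses).
WHAT IS NOT HERE: Bałaban's `Q`, `G̃₂`, the regions, the weight (instance data; MODEL lane); the walk structure.

ABSOLUTE RULE.  Nothing printed is cited as a fact; (3.24) ∕ (3.42) ∕ (2.16) are LOCATORS of shapes.  Nothing of
other lineages restated (BY NAME: an4 `MultiscaleCombesThomas.combesThomas_local` ∕ `isUnit_of_localConjCoercive`;
b13 `WRS`, `WRS.of_majorant`, `WRS.of_entrywise`, `WRS.sub_apply_zero_of_differentiableOn`; b05 `nsq`; this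
lineage's `sandwich`, `differentiableOn_sandwich`).  Row D4: NODE A's (I3)∕(2.16) consumer currency with local
prefactors; class of (T3) ∕ NODE O.2 UNCHANGED (critical-path width 0); D4 DISCHARGE NO DATE; NOT BetaPertH,
NOT continuum, NOT Clay, NOT summit progress.
-/

open scoped BigOperators Matrix ComplexConjugate
open Finset Complex Matrix Metric

namespace Summit.QuantumFields.BalabanUV.Beta.AccretiveCombesThomasSandwichLocal

open Summit.QuantumFields.BalabanUV.Beta.AccretiveCombesThomas
open Summit.QuantumFields.BalabanUV.Beta.AccretiveCombesThomasSandwich (sandwich differentiableOn_sandwich)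
open Summit.QuantumFields.BalabanUV.Beta.MultiscaleCombesThomas (combesThomas_local isUnit_of_localConjCoercive)
open Literature.MathematicalPhysics.QuantumFieldTheory.Balaban1983to89.B5Prop11Lower (nsq nsq_nonneg)
open Literature.MathematicalPhysics.QuantumFieldTheory.Balaban1983to89.B13PerturbativeStep (WRS)
open Literature.MathematicalPhysics.QuantumFieldTheory.Balaban1983to89
  (B13PerturbativeStep.WRS.of_majorant B13PerturbativeStep.WRS.of_entrywise
    B13PerturbativeStep.WRS.sub_apply_zero_of_differentiableOn)

noncomputable section

variable {X Y : Type*} [Fintype X] [DecidableEq X] [Fintype Y]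

/-! ## §1 The sandwich entry from the LOCAL pairing bound -/

omit [Fintype Y] in
/-- **The `Q`-sandwich entry, local form.**  If `A` is locally conjugated-coercive with a fine-site profile
`μ > 0` along every block-constant weight `x ↦ D(blk x, y′)` (rate `κ ≥ 0`, `D(y′,y′) = 0`), and the test vectors
`q_y` are supported in block `y`, then
`|q_y^* A⁻¹ q_{y′}| ≤ e^{−κ D(y,y′)}·√(Σ_x ‖q_y(x)‖²/μ_x)·√(Σ_x ‖q_{y′}(x)‖²/μ_x)` — an4's `combesThomas_local` BY NAME
with `u = q_y`, `v = q_{y′}`, `x = A⁻¹q_{y′}`. [folklore] -/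
theorem norm_sandwich_inv_le_local (A : Matrix X X ℂ) (blk : X → Y) (D : Y → Y → ℝ) (hD0 : ∀ y, D y y = 0)
    (q : Y → X → ℂ) (hq : ∀ y x, blk x ≠ y → q y x = 0) {κ : ℝ} {μ : X → ℝ} (hκ : 0 ≤ κ) (hμ : ∀ x, 0 < μ x)
    (hc : ∀ y', ∀ z : X → ℂ, ∑ x, μ x * ‖z x‖ ^ 2 ≤ (conjForm A κ (fun x => D (blk x) y') z).re) (y y' : Y) :
    ‖star (q y) ⬝ᵥ (A⁻¹ *ᵥ q y')‖ ≤ Real.exp (-(κ * D y y')) *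
      (Real.sqrt (∑ x, (μ x)⁻¹ * ‖q y x‖ ^ 2) * Real.sqrt (∑ x, (μ x)⁻¹ * ‖q y' x‖ ^ 2)) := by
  have hAu : IsUnit A := isUnit_of_localConjCoercive hμ (hc y')
  have hdet : IsUnit A.det := (Matrix.isUnit_iff_isUnit_det A).mp hAu
  have hx : A *ᵥ (A⁻¹ *ᵥ q y') = q y' := by
    rw [Matrix.mulVec_mulVec, Matrix.mul_nonsing_inv A hdet, Matrix.one_mulVec]
  exact combesThomas_local (fun x => D (blk x) y') hμ hκ (hc y') hx
    (fun x hx' => by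
      by_cases hb : blk x = y
      · simp only [hb]; exact le_rfl
      · exact absurd (hq y x hb) hx')
    (fun x hx' => by
      by_cases hb : blk x = y'
      · simp only [hb, hD0]; exact le_rfl
      · exact absurd (hq y' x hb) hx')

/-! ## §2 Block-constant profiles: the geometric-mean local prefactor -/

omit [Fintype Y] [DecidableEq X] in
/-- Under a block-constant profile `μ_x = ν(blk x)` the weighted mass of a block vector is `‖q_y‖²/ν_y`. [folklore] -/
theorem sum_inv_mul_norm_sq_eq (blk : X → Y) (ν : Y → ℝ) (q : Y → X → ℂ) (hq : ∀ y x, blk x ≠ y → q y x = 0)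
    (y : Y) : ∑ x, (ν (blk x))⁻¹ * ‖q y x‖ ^ 2 = (ν y)⁻¹ * nsq (q y) := by
  rw [nsq, Finset.mul_sum]
  refine Finset.sum_congr rfl fun x _ => ?_
  by_cases hb : blk x = y
  · rw [hb]
  · rw [hq y x hb]; simp

omit [Fintype X] [Fintype Y] [DecidableEq X] in
/-- The square-root bookkeeping: `√(p/a)·√(r/b) ≤ N/√(ab)` for `0 ≤ p, r ≤ N`, `0 < a, b`. [folklore] -/
theorem sqrt_inv_mul_mul_le {a b p r N : ℝ} (ha : 0 < a) (hb : 0 < b) (hp : 0 ≤ p) (hr : 0 ≤ r) (hpN : p ≤ N)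
    (hrN : r ≤ N) : Real.sqrt (a⁻¹ * p) * Real.sqrt (b⁻¹ * r) ≤ N / Real.sqrt (a * b) := by
  have hN : 0 ≤ N := hp.trans hpN
  rw [← Real.sqrt_mul (mul_nonneg (inv_nonneg.mpr ha.le) hp)]
  have hle : a⁻¹ * p * (b⁻¹ * r) ≤ N * N / (a * b) := by
    rw [show a⁻¹ * p * (b⁻¹ * r) = p * r / (a * b) by field_simp]
    exact div_le_div_of_nonneg_right (mul_le_mul hpN hrN hr hN) (mul_pos ha hb).le
  calc Real.sqrt (a⁻¹ * p * (b⁻¹ * r)) ≤ Real.sqrt (N * N / (a * b)) := Real.sqrt_le_sqrt hle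
    _ = N / Real.sqrt (a * b) := by rw [Real.sqrt_div' _ (mul_pos ha hb).le, Real.sqrt_mul_self hN]

omit [Fintype Y] in
/-- **The `Q`-sandwich entry with the GEOMETRIC-MEAN local prefactor.**  `A` locally conjugated-coercive with the
block-constant profile `x ↦ ν(blk x)`, `ν > 0`, along every weight `x ↦ D(blk x, y′)`; `q_y` supported in block `y`
with `‖q_y‖² ≤ N` ⟹ `|q_y^* A⁻¹ q_{y′}| ≤ N·e^{−κ D(y,y′)}/√(ν_y ν_{y′})`.  For the multi-region operator
(`ν_y = κ₀(L^{j(y)}η)⁻²`) the prefactor is `(L^{j(y)}η)(L^{j(y′)}η)/κ₀` — the ENTRY ∕ ℓ²-pairing currency of the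
local-prefactor shape; with a constant profile `ν ≡ m` it is `AccretiveCombesThomasSandwich.norm_sandwich_inv_le`'s
bound `N·e^{−κD}/m`. [cite: Balaban1985BackgroundPropagators, Thm 3.1 (3.42) p.397] [folklore] -/
theorem norm_sandwich_inv_le_blockLocal (A : Matrix X X ℂ) (blk : X → Y) (D : Y → Y → ℝ) (hD0 : ∀ y, D y y = 0)
    (q : Y → X → ℂ) (hq : ∀ y x, blk x ≠ y → q y x = 0) {N : ℝ} (hN : ∀ y, nsq (q y) ≤ N)
    {κ : ℝ} {ν : Y → ℝ} (hκ : 0 ≤ κ) (hν : ∀ y, 0 < ν y)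
    (hc : ∀ y', ∀ z : X → ℂ, ∑ x, ν (blk x) * ‖z x‖ ^ 2 ≤ (conjForm A κ (fun x => D (blk x) y') z).re)
    (y y' : Y) :
    ‖star (q y) ⬝ᵥ (A⁻¹ *ᵥ q y')‖ ≤ N * Real.exp (-(κ * D y y')) / Real.sqrt (ν y * ν y') := by
  have h := norm_sandwich_inv_le_local A blk D hD0 q hq hκ (μ := fun x => ν (blk x)) (fun x => hν (blk x))
    hc y y'
  rw [sum_inv_mul_norm_sq_eq blk ν q hq y, sum_inv_mul_norm_sq_eq blk ν q hq y'] at h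
  have hsq := sqrt_inv_mul_mul_le (hν y) (hν y') (nsq_nonneg (q y)) (nsq_nonneg (q y')) (hN y) (hN y')
  calc ‖star (q y) ⬝ᵥ (A⁻¹ *ᵥ q y')‖
      ≤ Real.exp (-(κ * D y y')) *
          (Real.sqrt ((ν y)⁻¹ * nsq (q y)) * Real.sqrt ((ν y')⁻¹ * nsq (q y'))) := h
    _ ≤ Real.exp (-(κ * D y y')) * (N / Real.sqrt (ν y * ν y')) :=
        mul_le_mul_of_nonneg_left hsq (Real.exp_pos _).le
    _ = N * Real.exp (-(κ * D y y')) / Real.sqrt (ν y * ν y') := by ring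

omit [Fintype Y] in
/-- **With a floor** `ν ≥ ν₀ > 0` the local entry bound dominates the global shape: `|q_y^* A⁻¹ q_{y′}| ≤
(N/ν₀)·e^{−κ D(y,y′)}`.  For the multi-region operator the floor is attained at the TOP scale (`ν₀ = κ₀(L^kη)⁻²`),
so this bound is `k`-uniform — reached through the LOCAL engine, not from a global conjugated-coercivity
hypothesis. [folklore] -/
theorem norm_sandwich_inv_le_floor (A : Matrix X X ℂ) (blk : X → Y) (D : Y → Y → ℝ) (hD0 : ∀ y, D y y = 0)
    (q : Y → X → ℂ) (hq : ∀ y x, blk x ≠ y → q y x = 0) {N : ℝ} (hN : ∀ y, nsq (q y) ≤ N)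
    {κ ν₀ : ℝ} {ν : Y → ℝ} (hκ : 0 ≤ κ) (hν0 : 0 < ν₀) (hfl : ∀ y, ν₀ ≤ ν y)
    (hc : ∀ y', ∀ z : X → ℂ, ∑ x, ν (blk x) * ‖z x‖ ^ 2 ≤ (conjForm A κ (fun x => D (blk x) y') z).re)
    (y y' : Y) :
    ‖star (q y) ⬝ᵥ (A⁻¹ *ᵥ q y')‖ ≤ N / ν₀ * Real.exp (-(κ * D y y')) := by
  have hν : ∀ y, 0 < ν y := fun y => hν0.trans_le (hfl y)
  have h := norm_sandwich_inv_le_blockLocal A blk D hD0 q hq hN hκ hν hc y y'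
  have hN0 : 0 ≤ N := (nsq_nonneg _).trans (hN y)
  have hfloor : ν₀ ≤ Real.sqrt (ν y * ν y') := by
    rw [show ν₀ = Real.sqrt (ν₀ * ν₀) from (Real.sqrt_mul_self hν0.le).symm]
    exact Real.sqrt_le_sqrt (mul_le_mul (hfl y) (hfl y') hν0.le (hν y).le)
  calc ‖star (q y) ⬝ᵥ (A⁻¹ *ᵥ q y')‖ ≤ N * Real.exp (-(κ * D y y')) / Real.sqrt (ν y * ν y') := h
    _ ≤ N * Real.exp (-(κ * D y y')) / ν₀ :=
        div_le_div_of_nonneg_left (mul_nonneg hN0 (Real.exp_pos _).le) hν0 hfloor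
    _ = N / ν₀ * Real.exp (-(κ * D y y')) := by ring

/-! ## §3 Weighted row sums of the sandwich matrix with local prefactors -/

/-- **WRS of the sandwich, local form** at any rate `κ′`, against the PROFILE-WEIGHTED unit-lattice sum
`Σ_{y′} e^{−(κ−κ′)D(y,y′)}/√(ν_y ν_{y′}) ≤ L`: `WRS κ′ D (sandwich A q) (N·L)` (`WRS.of_majorant` BY NAME). [folklore] -/
theorem wrs_sandwich_inv_local (A : Matrix X X ℂ) (blk : X → Y) (D : Y → Y → ℝ) (hD0 : ∀ y, D y y = 0)
    (q : Y → X → ℂ) (hq : ∀ y x, blk x ≠ y → q y x = 0) {N : ℝ} (hN0 : 0 ≤ N) (hN : ∀ y, nsq (q y) ≤ N)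
    {κ κ' L : ℝ} {ν : Y → ℝ} (hκ : 0 ≤ κ) (hν : ∀ y, 0 < ν y)
    (hc : ∀ y', ∀ z : X → ℂ, ∑ x, ν (blk x) * ‖z x‖ ^ 2 ≤ (conjForm A κ (fun x => D (blk x) y') z).re)
    (hL : ∀ y, ∑ y', Real.exp (-((κ - κ') * D y y')) / Real.sqrt (ν y * ν y') ≤ L) :
    WRS κ' D (sandwich A q) (N * L) := by
  refine B13PerturbativeStep.WRS.of_majorant
    (m := fun y y' => N * Real.exp (-(κ * D y y')) / Real.sqrt (ν y * ν y'))
    (fun y y' => norm_sandwich_inv_le_blockLocal A blk D hD0 q hq hN hκ hν hc y y') fun y => ?_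
  calc ∑ y', N * Real.exp (-(κ * D y y')) / Real.sqrt (ν y * ν y') * Real.exp (κ' * D y y')
      = N * ∑ y', Real.exp (-((κ - κ') * D y y')) / Real.sqrt (ν y * ν y') := by
        rw [Finset.mul_sum]
        refine Finset.sum_congr rfl fun y' _ => ?_
        rw [show -((κ - κ') * D y y') = -(κ * D y y') + κ' * D y y' by ring, Real.exp_add]
        ring
    _ ≤ N * L := mul_le_mul_of_nonneg_left (hL y) hN0

/-- **WRS of the sandwich with a floor** `ν ≥ ν₀ > 0` and the plain unit-lattice profile
`Σ_{y′} e^{−(κ−κ′)D(y,y′)} ≤ L`: `WRS κ′ D (sandwich A q) (N/ν₀ · L)` (`WRS.of_entrywise` BY NAME) — the `k`-uniform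
shape of `AccretiveCombesThomasSandwich.wrs_sandwich_inv` with `m` replaced by the floor of the LOCAL profile. [folklore] -/
theorem wrs_sandwich_inv_floor (A : Matrix X X ℂ) (blk : X → Y) (D : Y → Y → ℝ) (hD0 : ∀ y, D y y = 0)
    (q : Y → X → ℂ) (hq : ∀ y x, blk x ≠ y → q y x = 0) {N : ℝ} (hN0 : 0 ≤ N) (hN : ∀ y, nsq (q y) ≤ N)
    {κ κ' ν₀ L : ℝ} {ν : Y → ℝ} (hκ : 0 ≤ κ) (hν0 : 0 < ν₀) (hfl : ∀ y, ν₀ ≤ ν y)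
    (hc : ∀ y', ∀ z : X → ℂ, ∑ x, ν (blk x) * ‖z x‖ ^ 2 ≤ (conjForm A κ (fun x => D (blk x) y') z).re)
    (hL : ∀ y, ∑ y', Real.exp (-((κ - κ') * D y y')) ≤ L) :
    WRS κ' D (sandwich A q) (N / ν₀ * L) :=
  B13PerturbativeStep.WRS.of_entrywise (θ := N / ν₀) (div_nonneg hN0 hν0.le)
    (fun y y' => norm_sandwich_inv_le_floor A blk D hD0 q hq hN hκ hν0 hfl hc y y') hL

/-! ## §4 The sandwiched inverse FAMILY under uniform LOCAL coercivity: (2.16)-shape END -/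

/-- **(2.16)-shape for SANDWICHED inverse families, local form.**  `σ ↦ A(σ)` entrywise holomorphic on `|σ| < R`
and, for every `σ` there, LOCALLY conjugated-coercive with the block-constant profile `ν ≥ ν₀ > 0` along the
block-constant weights; test vectors `q_y` supported in block `y` with `‖q_y‖² ≤ N`; unit-lattice profile
`Σ_{y′} e^{−(κ−κ′)D(y,y′)} ≤ L`.  Then for every `σ` in the disc `WRS κ′ D (S_σ − S_0) (2(N/ν₀·L)/R·‖σ‖)`,
`S_σ = sandwich (A σ) q` — `WRS.sub_apply_zero_of_differentiableOn` BY NAME; invertibility along the disc from an4's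
`isUnit_of_localConjCoercive`. [cite: Balaban1988RG2Cluster, (2.16) p.16] [folklore] -/
theorem wrs_sandwich_sub_zero_local [Nonempty Y] {A : ℂ → Matrix X X ℂ} (blk : X → Y) (D : Y → Y → ℝ)
    (hD0 : ∀ y, D y y = 0) (q : Y → X → ℂ) (hq : ∀ y x, blk x ≠ y → q y x = 0) {N : ℝ} (hN0 : 0 ≤ N)
    (hN : ∀ y, nsq (q y) ≤ N) {κ κ' ν₀ R L : ℝ} {ν : Y → ℝ} (hR : 0 < R) (hκ : 0 ≤ κ) (hν0 : 0 < ν₀)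
    (hfl : ∀ y, ν₀ ≤ ν y) (ha : ∀ i j, DifferentiableOn ℂ (fun σ => A σ i j) (ball 0 R))
    (hc : ∀ σ ∈ ball (0 : ℂ) R, ∀ y', ∀ z : X → ℂ,
      ∑ x, ν (blk x) * ‖z x‖ ^ 2 ≤ (conjForm (A σ) κ (fun x => D (blk x) y') z).re)
    (hL : ∀ y, ∑ y', Real.exp (-((κ - κ') * D y y')) ≤ L) {σ : ℂ} (hσ : σ ∈ ball (0 : ℂ) R) :
    WRS κ' D (sandwich (A σ) q - sandwich (A 0) q) (2 * (N / ν₀ * L) / R * ‖σ‖) := by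
  have hν : ∀ y, 0 < ν y := fun y => hν0.trans_le (hfl y)
  have hU : ∀ τ ∈ ball (0 : ℂ) R, IsUnit (A τ) := fun τ hτ =>
    isUnit_of_localConjCoercive (μ := fun x => ν (blk x)) (fun x => hν (blk x)) (hc τ hτ (Classical.arbitrary Y))
  have ha' : ∀ y y', DifferentiableOn ℂ (fun τ => sandwich (A τ) q y y') (ball 0 R) :=
    fun y y' => differentiableOn_sandwich ha hU q y y'
  have hm' : ∀ τ ∈ ball (0 : ℂ) R, ∀ y y', ‖sandwich (A τ) q y y'‖ ≤ N / ν₀ * Real.exp (-(κ * D y y')) :=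
    fun τ hτ y y' => norm_sandwich_inv_le_floor (A τ) blk D hD0 q hq hN hκ hν0 hfl (hc τ hτ) y y'
  have hρ : ∀ y, ∑ y', N / ν₀ * Real.exp (-(κ * D y y')) * Real.exp (κ' * D y y') ≤ N / ν₀ * L := by
    intro y
    calc ∑ y', N / ν₀ * Real.exp (-(κ * D y y')) * Real.exp (κ' * D y y')
        = N / ν₀ * ∑ y', Real.exp (-((κ - κ') * D y y')) := by
          rw [Finset.mul_sum]
          refine Finset.sum_congr rfl fun y' _ => ?_
          rw [mul_assoc, ← Real.exp_add]
          ring_nf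
      _ ≤ N / ν₀ * L := mul_le_mul_of_nonneg_left (hL y) (div_nonneg hN0 hν0.le)
  exact B13PerturbativeStep.WRS.sub_apply_zero_of_differentiableOn (A := fun τ => sandwich (A τ) q) hR ha' hm'
    hρ hσ

/-! ## §5 Witness: the hypothesis list of §2 is jointly satisfiable -/

/-- One fine site, one block, `A = (2)`, profile `ν ≡ 2`, `q ≡ 1`, `D ≡ 0`: the local hypothesis holds (with
equality) and `norm_sandwich_inv_le_blockLocal` fires, giving `|1·A⁻¹·1| ≤ 1·e^0/√(2·2)`. [folklore] -/
example (κ : ℝ) (hκ : 0 ≤ κ) :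
    ‖star (fun _ : Unit => (1 : ℂ)) ⬝ᵥ ((((2 : ℝ) : ℂ) • (1 : Matrix Unit Unit ℂ))⁻¹ *ᵥ fun _ : Unit => (1 : ℂ))‖ ≤
      1 * Real.exp (-(κ * 0)) / Real.sqrt (2 * 2) := by
  refine norm_sandwich_inv_le_blockLocal (((2 : ℝ) : ℂ) • (1 : Matrix Unit Unit ℂ)) (fun _ => ()) (fun _ _ => 0)
    (fun _ => rfl) (fun _ _ => 1) (fun _ _ h => absurd rfl h) (N := 1) (fun _ => by simp [nsq]) hκ
    (ν := fun _ => 2) (fun _ => by norm_num) (fun _ z => ?_) () ()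
  -- the local hypothesis: `Σ 2‖z‖² ≤ Re conjForm (2·1) κ 0 z = 2‖z‖²`
  simp only [conjForm, Fintype.univ_ofSubsingleton, Finset.sum_singleton, sub_self, mul_zero, Real.exp_zero,
    Complex.ofReal_one, mul_one, Matrix.smul_apply, Matrix.one_apply_eq, smul_eq_mul]
  rw [show (starRingEnd ℂ) (z ()) * ((2 : ℝ) : ℂ) * z () = ((2 : ℝ) : ℂ) * ((starRingEnd ℂ) (z ()) * z ())
    by ring, Complex.conj_mul' (z ())]
  have h2 : ((2 : ℝ) : ℂ) * ((‖z ()‖ : ℂ) ^ 2) = ((2 * ‖z ()‖ ^ 2 : ℝ) : ℂ) := by push_cast; ring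
  rw [h2, Complex.ofReal_re]

end

end Summit.QuantumFields.BalabanUV.Beta.AccretiveCombesThomasSandwichLocal
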